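import Literature.MathematicalPhysics.QuantumFieldTheory.Balaban1983to89.B8IdxB8SubDPeriodicTowers

/-!
# NODE 00 (YM-PLAN Track A) — THE PERIODIC (1.5)-OBEYING ADMISSIBLE SUB-INDEX OF RECORD `IdxB8SubDPer θ P`: the members `j : IdxB8SubD θ` (`Ω₀ = ℤᵈ`, the located laws, (1.3)–(1.5))
# whose domains `Ω_l` are `P`-PERIODIC on the universal cover `ℤᵈ` of the torus `(ℤ/Pℤ)ᵈ`, with the tiling law `Lᵏ ∣ P` (every level's block lattice divides the period) and `0 < P`;
# faces; the torus reading of the domains (finite sets of `(ℤ/Pℤ)ᵈ`); the characterisation; inhabitants at every depth and period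

[Balaban1985RegularSpaces] = T. Bałaban, *Spaces of regular gauge field configurations on a lattice and gauge fixing conditions*, Commun. Math. Phys. **99** (1985) 75–102
— p. 77 «Let us consider a sequence of domains Ω₀ ⊃ Ω₁ ⊃ … ⊃ Ω_k, Ω_j ⊂ T_η … we admit the case where some domains Ω_j are equal to T_η» (the domains live on the TORUS `T_η`),
(1.3)–(1.6) p. 77, (1.131) p. 99.  [Balaban1987RG1] (0.1) p. 251 (the torus by identification of the faces of a cube — the tree's `T4TermwiseTorus.IsPeriodic ∕ tcls ∕ tlift`).

NODE 00 CARRIER MODULE (width seat `pub-ymgap-dag-n05-w1` g3, 2026-08-28 — pen P2 of plan g86's PENS-217 for director-ym №217 (1)(c) «the (β′-PERIODIC) road behind the ∅ [B8] display: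
periodic data ON the ℤᵈ carrier»; FIRST of the pen's two modules — the INDEX; the carriers ∕ pin ∕ door module `Node00/CarriersB8Per` follows on top of dag-n05-c's periodic member model
`B8LeafModelZdPer`).  The SAME Subtype-over-the-lineage pattern as `IdxB8SubD` over `IdxB8SubC` (this seat g2, `Node00/CarriersB8SubD`): `Subtype.val` composes with everything keyed on
`IdxB8SubD ∕ SubC ∕ SubB ∕ IdxB8 ∕ ZdIdx`.  APPEND-ONLY: a NEW importing module; `Node00/CarriersB8SubD`, `B8IdxB8SubDRigidity` (dag-n05-w2 g4: rigidity + the characterisation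
`exists_idxB8SubD_iff`), `B8IdxB8SubDPeriodicTowers` (dag-n05-w2 g6: the towers' periodicity from the Ω-law), `T4TermwiseTorus` (the periodicity predicate of record `IsPeriodic` and the torus
classes) and everything below them CONSUMED BY NAME, nothing edited.

WHY (director-ym №217 (1), dag-n05-d g14's JUNCTION ROAD NOTE v2, dag-n05-c g16's ADDENDUM).  `IdxB8` forces `Ω 0 = ℤᵈ` (Theorem 2 ∕ Theorem 8 are boundary-refuted on every other member), while
N06's [Balaban1985BackgroundPropagators] objects live at FINITE `Ω₀` only; the junction J-N06→N05 therefore closes on members whose data are PERIODIC on `ℤᵈ` — i.e. data on a finite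
torus `(ℤ/Pℤ)ᵈ` read on the universal cover, which is print's own setting (p. 77: `Ω_j ⊂ T_η`).  THE PERIODICITY LAW IS Ω-ONLY (dag-n05-w2 g6's reading): on `IdxB8SubD` the constraint
towers `Λs m l` ∕ bond classes `Λb m l` ARE print's level sets of the domains (RIGIDITY, `B8IdxB8SubDRigidity.IdxB8SubD.Λs_eq_lam ∕ .Λb_eq_towerBonds_lam`), so their periodicity in
level-`l` labels (period `P ∕ Lˡ`) is a THEOREM of the Ω-law + the tiling law (dag-n05-w2's `B8IdxB8SubDPeriodicTowers`), not a law field.  Field periodicity (configurations,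
sources, gauge transformations) is the member MODEL's business (dag-n05-c's `B8LeafModelZdPer.zdGF3Per`, same predicate `T4TermwiseTorus.IsPeriodic P`).

WHAT IS DEFINED ∕ PROVED (6 `def` + faces; 0 sorry): `IdxB8SubDPer θ P` (def) · `IdxB8SubDPer.toSubD` (`= Subtype.val`, rfl) · `.toZdIdx` (the member's geometric datum, rfl) · `.toIdxB8` (the member in `IdxB8 θ`) · `.pos` ·
`.dvd` · `.periodic` · `.mem_Ω_add_smul_iff` · `.mem_Ω_sub_smul_iff` · `.dvd_level` · `.lamTop ∕ .domainSeq ∕ .lawsB ∕ .laws ∕ .Ω_zero ∕ .collar` (through `toSubD`) · `.Λs_eq_lam ∕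
.Λb_eq_towerBonds_lam` (rigidity by name) · ★ `.isPeriodic_Λs ∕ .isPeriodic_Λb` + `.mem_Λs_add_smul_iff ∕ .mem_Λb_add_smul_iff` (THE TOWERS ARE `(P∕Lˡ)`-PERIODIC BY THEOREM — dag-n05-w2's
`…PeriodicTowers` by name) · `.pow_mul_div ∕ .div_pos` · `.mulPeriod` (a `P`-periodic member as an `n·P`-periodic one) · THE TORUS READING `IdxB8SubDPer.ΩTorus j l ⊂ (ℤ/Pℤ)ᵈ` (def) with
`.tcls_mem_ΩTorus_iff` («`x ∈ Ω_l` iff its torus class is in `Ω_l^𝕋`»), `.tcls_preimage_ΩTorus` (`Ω_l` IS the pull-back), `.ΩTorus_finite`, `.ΩTorus_zero`, `.ΩTorus_anti` ·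
★ `exists_idxB8SubDPer_iff` (CHARACTERISATION: `(η, k, Ω)` is carried by a member iff admissible ∧ `P`-periodic ∧ `0 < P` ∧ `Lᵏ ∣ P`) · ★ `exists_idxB8SubDPer_univTower` ∕
`nonempty_idxB8SubDPer` (INHABITANTS: print's all-torus tower «Ω_j = T_η for all j» at every depth `k ≥ 1` and every period `P > 0` with `Lᵏ ∣ P`).
HONEST FRAMING: one index definition (a Subtype by a periodicity text) + one reading + bookkeeping; NO estimate; nothing of Bałaban asserted; N05 NOT discharged (№217 (1)(b): judged at
`B8LeafRS` ∕ `upOfRecord₅CS` with periodic data and the `c₁ ∕ ρ₀` guard); count-neutral; one finite T⁴ programme at fixed ε, Bałaban AS PRINTED — NOT continuum ∕ ℝ⁴ ∕ OS ∕ mass gap ∕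
Clay.  No `sorry`, no `instance`, no `notation`. -/

noncomputable section

namespace Literature.MathematicalPhysics.QuantumFieldTheory.Balaban1983to89.Node00

open B7Prop1Explicit B7Prop1Local
open B8LeafModelZd (ZdIdx)
open B8ConstraintBonds (DomainSeq Lam)
open B8IdxB8LawsB (IdxB8LawsB towerBonds)
open B8LeafModelZd3P (EndBlockIn)
open T4TermwiseTorus (IsPeriodic tcls tlift)

variable (θ : Stage3Params)

/-- **THE PERIODIC (1.5)-OBEYING ADMISSIBLE SUB-INDEX OF RECORD** `IdxB8SubDPer θ P`: the members `j : IdxB8SubD θ` with `0 < P`, the tiling law `θ.L ^ k ∣ P` (every level-`l` block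
lattice `Lˡℤᵈ`, `l ≤ k`, divides the period lattice `Pℤᵈ`) and every domain `Ω_l` `P`-periodic on `ℤᵈ` in the tree's predicate of record `T4TermwiseTorus.IsPeriodic P (· ∈ Ω_l)` —
print's «Ω_j ⊂ T_η» read on the universal cover of the torus `T_η = (ℤ/Pℤ)ᵈ·η`.  Ω-ONLY: the towers' periodicity follows by rigidity.
[cite: Balaban1985RegularSpaces, p.77 («Ω_j ⊂ T_η … we admit Ω_j = T_η»), (1.3)–(1.5) p.77; Balaban1987RG1, (0.1) p.251] -/
def IdxB8SubDPer (P : ℕ) : Type :=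
  {j : IdxB8SubD θ // (0 < P ∧ θ.L ^ j.1.1.1.1.k ∣ P) ∧ ∀ l, IsPeriodic P (fun x : B7Prop1Explicit.Site θ.D => x ∈ j.1.1.1.1.Ω l)}

variable {θ} {P : ℕ}

/-- The forgetful map to the (1.5)-obeying admissible sub-index (`Subtype.val`). [cite: Balaban1985RegularSpaces, (1.3)–(1.5) p.77 (bookkeeping)] -/
def IdxB8SubDPer.toSubD (j : IdxB8SubDPer θ P) : IdxB8SubD θ := j.1

/-- `toSubD` is the first projection (`rfl`). [cite: Balaban1985RegularSpaces, p.77 (bookkeeping)] -/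
theorem IdxB8SubDPer.toSubD_eq (j : IdxB8SubDPer θ P) : j.toSubD = j.1 := rfl

/-- The member's geometric datum `(η, k, {Ω_l}, Λs, Λb, laws)` — n05-a's `ZdIdx` (the argument of every member model `zdGF3 ∕ zdGF3Per`). [cite: Balaban1985RegularSpaces, (1.3)–(1.5) p.77, (1.28)–(1.29) p.81 (bookkeeping)] -/
def IdxB8SubDPer.toZdIdx (j : IdxB8SubDPer θ P) : ZdIdx θ.D θ.L := j.1.1.1.1.1

/-- `toZdIdx` unfolded (`rfl`). [cite: Balaban1985RegularSpaces, p.77 (bookkeeping)] -/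
theorem IdxB8SubDPer.toZdIdx_eq (j : IdxB8SubDPer θ P) : j.toZdIdx = j.1.1.1.1.1 := rfl

/-- The member in print's admitted index `IdxB8 θ` (`Ω₀ = ℤᵈ`) — the argument of the family of record `famB8OfRecord`. [cite: Balaban1985RegularSpaces, p.77 («Ω_j = T_η»; bookkeeping)] -/
def IdxB8SubDPer.toIdxB8 (j : IdxB8SubDPer θ P) : IdxB8 θ := j.1.1.1.1

/-- `toIdxB8` carries the member's geometric datum (`rfl`). [cite: Balaban1985RegularSpaces, p.77 (bookkeeping)] -/
theorem IdxB8SubDPer.toIdxB8_val (j : IdxB8SubDPer θ P) : j.toIdxB8.1 = j.toZdIdx := rfl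

/-- The period is positive. [cite: Balaban1987RG1, (0.1) p.251 (bookkeeping)] -/
theorem IdxB8SubDPer.pos (j : IdxB8SubDPer θ P) : 0 < P := j.2.1.1

/-- **The tiling law**: the top block lattice divides the period, `Lᵏ ∣ P`. [cite: Balaban1985RegularSpaces, p.77 («Ω_j ⊂ T_η», unions of big blocks); Balaban1987RG1, (0.1) p.251] -/
theorem IdxB8SubDPer.dvd (j : IdxB8SubDPer θ P) : θ.L ^ j.1.1.1.1.1.k ∣ P := j.2.1.2

/-- Every level's block lattice divides the period: `Lˡ ∣ P` for `l ≤ k`. [cite: Balaban1985RegularSpaces, p.77 (bookkeeping)] -/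
theorem IdxB8SubDPer.dvd_level (j : IdxB8SubDPer θ P) {l : ℕ} (hl : l ≤ j.1.1.1.1.1.k) : θ.L ^ l ∣ P :=
  (pow_dvd_pow θ.L hl).trans j.dvd

/-- **The periodicity law**: every domain `Ω_l` is `P`-periodic on `ℤᵈ`. [cite: Balaban1985RegularSpaces, p.77 («Ω_j ⊂ T_η»); Balaban1987RG1, (0.1) p.251] -/
theorem IdxB8SubDPer.periodic (j : IdxB8SubDPer θ P) (l : ℕ) : IsPeriodic P (fun x : B7Prop1Explicit.Site θ.D => x ∈ j.1.1.1.1.1.Ω l) := j.2.2 l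

/-- The periodicity law as an `↔`: `x + P•m ∈ Ω_l ↔ x ∈ Ω_l`. [cite: Balaban1985RegularSpaces, p.77 (bookkeeping)] -/
theorem IdxB8SubDPer.mem_Ω_add_smul_iff (j : IdxB8SubDPer θ P) (l : ℕ) (x m : B7Prop1Explicit.Site θ.D) :
    x + (P : ℤ) • m ∈ j.1.1.1.1.1.Ω l ↔ x ∈ j.1.1.1.1.1.Ω l :=
  Iff.of_eq (j.periodic l x m)

/-- … and backwards: `x - P•m ∈ Ω_l ↔ x ∈ Ω_l`. [cite: Balaban1985RegularSpaces, p.77 (bookkeeping)] -/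
theorem IdxB8SubDPer.mem_Ω_sub_smul_iff (j : IdxB8SubDPer θ P) (l : ℕ) (x m : B7Prop1Explicit.Site θ.D) :
    x - (P : ℤ) • m ∈ j.1.1.1.1.1.Ω l ↔ x ∈ j.1.1.1.1.1.Ω l := by
  rw [sub_eq_add_neg, ← smul_neg]
  exact j.mem_Ω_add_smul_iff l x (-m)

/-- The member's (1.5) reading (through `toSubD`). [cite: Balaban1985RegularSpaces, (1.5) p.77] -/
theorem IdxB8SubDPer.lamTop (j : IdxB8SubDPer θ P) :
    ∀ l, l < j.1.1.1.1.1.k → ∀ z ∈ j.1.1.1.1.1.Λs j.1.1.1.1.1.k l, ((θ.L : ℤ) ^ l) • z ∈ Lam θ.L j.1.1.1.1.1.Ω l :=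
  j.1.lamTop

/-- The member's (1.3)–(1.4) domain law. [cite: Balaban1985RegularSpaces, (1.3)–(1.4) p.77] -/
theorem IdxB8SubDPer.domainSeq (j : IdxB8SubDPer θ P) : DomainSeq θ.L j.1.1.1.1.1.Ω := j.1.domainSeq

/-- The member's four located laws. [cite: Balaban1985RegularSpaces, (1.5)–(1.6) p.77, p.86] -/
theorem IdxB8SubDPer.lawsB (j : IdxB8SubDPer θ P) : IdxB8LawsB θ.L j.1.1.1.1.1 := j.1.lawsB

/-- The member's three located laws of `Node00.IdxB8Laws`. [cite: Balaban1985RegularSpaces, (1.6) p.77, (1.19) p.79, (1.34) p.82] -/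
theorem IdxB8SubDPer.laws (j : IdxB8SubDPer θ P) : IdxB8Laws θ.L j.1.1.1.1.1 := j.1.laws

/-- The member's `Ω₀ = ℤᵈ` (the whole torus, read on the cover). [cite: Balaban1985RegularSpaces, p.77 («Ω_j = T_η»)] -/
theorem IdxB8SubDPer.Ω_zero (j : IdxB8SubDPer θ P) : j.1.1.1.1.1.Ω 0 = Set.univ := j.1.Ω_zero

/-- The member's (1.4) axis collar. [cite: Balaban1985RegularSpaces, (1.3)–(1.4) p.77] -/
theorem IdxB8SubDPer.collar (j : IdxB8SubDPer θ P) :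
    ∀ l, l ≤ j.1.1.1.1.1.k → ∀ (z : B7Prop1Explicit.Site θ.D) (μ : Fin θ.D), EndBlockIn θ.L (j.1.1.1.1.1.Ω l) l z μ →
      ∀ x, InBox (loK θ.L l z) (bondHiK θ.L l z μ) x → x ∈ j.1.1.1.1.1.Ω (l - 1) :=
  j.1.collar

/-- RIGIDITY by name: the member's constraint families ARE print's level sets of its domains (`l ≤ m ≤ k`). [cite: Balaban1985RegularSpaces, (1.5)–(1.6) p.77, (1.68) p.88] -/
theorem IdxB8SubDPer.Λs_eq_lam (j : IdxB8SubDPer θ P) {m : ℕ} (hm : m ≤ j.1.1.1.1.1.k) {l : ℕ} (hl : l ≤ m) :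
    j.1.1.1.1.1.Λs m l = B11Eq7Convention.Lam θ.L j.1.1.1.1.1.Ω m l :=
  B8IdxB8SubDRigidity.IdxB8SubD.Λs_eq_lam j.1 hm hl

/-- RIGIDITY by name: the member's bond classes ARE the tower bonds of those level sets (`l ≤ m ≤ k`). [cite: Balaban1985RegularSpaces, (1.31) p.82, p.86 («𝔅_k»), (1.5) p.77] -/
theorem IdxB8SubDPer.Λb_eq_towerBonds_lam (j : IdxB8SubDPer θ P) {m : ℕ} (hm : m ≤ j.1.1.1.1.1.k) {l : ℕ} (hl : l ≤ m) :
    j.1.1.1.1.1.Λb m l = towerBonds θ.L j.1.1.1.1.1.Ω (B11Eq7Convention.Lam θ.L j.1.1.1.1.1.Ω m) l :=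
  B8IdxB8SubDRigidity.IdxB8SubD.Λb_eq_towerBonds_lam j.1 hm hl

/-- **THE TOWERS ARE PERIODIC BY THEOREM** (dag-n05-w2 g6's `B8IdxB8SubDPeriodicTowers.IdxB8SubD.isPeriodic_Λs_of_dvd` BY NAME): at a periodic member every constraint family `Λs m l`
(`l ≤ m ≤ k`) is `(P ∕ Lˡ)`-periodic in level-`l` labels — rigidity (the towers are print's level sets of the `Ω_l`) + the tiling law. [cite: Balaban1985RegularSpaces, (1.5)–(1.6) p.77, (1.68) p.88, p.77 («Ω_j ⊂ T_η»)] -/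
theorem IdxB8SubDPer.isPeriodic_Λs (j : IdxB8SubDPer θ P) {m : ℕ} (hm : m ≤ j.1.1.1.1.1.k) {l : ℕ} (hl : l ≤ m) :
    IsPeriodic (P / θ.L ^ l) (fun z : B7Prop1Explicit.Site θ.D => z ∈ j.1.1.1.1.1.Λs m l) :=
  B8IdxB8SubDPeriodicTowers.IdxB8SubD.isPeriodic_Λs_of_dvd j.1 (fun l _ => j.periodic l) j.dvd hm hl

/-- … and every `κ`-section of every bond class `Λb m l` (`l ≤ m ≤ k`) is `(P ∕ Lˡ)`-periodic (dag-n05-w2's `IdxB8SubD.isPeriodic_Λb_of_dvd` BY NAME). [cite: Balaban1985RegularSpaces, (1.31) p.82, p.86 («𝔅_k»), p.77 («Ω_j ⊂ T_η»)] -/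
theorem IdxB8SubDPer.isPeriodic_Λb (j : IdxB8SubDPer θ P) {m : ℕ} (hm : m ≤ j.1.1.1.1.1.k) {l : ℕ} (hl : l ≤ m) (κ : Fin θ.D) :
    IsPeriodic (P / θ.L ^ l) (fun z : B7Prop1Explicit.Site θ.D => (z, κ) ∈ j.1.1.1.1.1.Λb m l) :=
  B8IdxB8SubDPeriodicTowers.IdxB8SubD.isPeriodic_Λb_of_dvd j.1 (fun l _ => j.periodic l) j.dvd hm hl κ

/-- The `↔` reading: `z + (P∕Lˡ)•v ∈ Λs m l ↔ z ∈ Λs m l`. [cite: Balaban1985RegularSpaces, (1.5)–(1.6) p.77 (bookkeeping)] -/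
theorem IdxB8SubDPer.mem_Λs_add_smul_iff (j : IdxB8SubDPer θ P) {m : ℕ} (hm : m ≤ j.1.1.1.1.1.k) {l : ℕ} (hl : l ≤ m) (z v : B7Prop1Explicit.Site θ.D) :
    z + ((P / θ.L ^ l : ℕ) : ℤ) • v ∈ j.1.1.1.1.1.Λs m l ↔ z ∈ j.1.1.1.1.1.Λs m l :=
  Iff.of_eq (j.isPeriodic_Λs hm hl z v)

/-- The `↔` reading: `(z + (P∕Lˡ)•v, κ) ∈ Λb m l ↔ (z, κ) ∈ Λb m l`. [cite: Balaban1985RegularSpaces, (1.31) p.82 (bookkeeping)] -/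
theorem IdxB8SubDPer.mem_Λb_add_smul_iff (j : IdxB8SubDPer θ P) {m : ℕ} (hm : m ≤ j.1.1.1.1.1.k) {l : ℕ} (hl : l ≤ m) (z v : B7Prop1Explicit.Site θ.D) (κ : Fin θ.D) :
    (z + ((P / θ.L ^ l : ℕ) : ℤ) • v, κ) ∈ j.1.1.1.1.1.Λb m l ↔ (z, κ) ∈ j.1.1.1.1.1.Λb m l :=
  Iff.of_eq (j.isPeriodic_Λb hm hl κ z v)

/-- The period of level-`l` labels times the block size is the fine period: `Lˡ · (P ∕ Lˡ) = P` (`l ≤ k`). [cite: Balaban1985RegularSpaces, p.77 (bookkeeping)] -/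
theorem IdxB8SubDPer.pow_mul_div (j : IdxB8SubDPer θ P) {l : ℕ} (hl : l ≤ j.1.1.1.1.1.k) : θ.L ^ l * (P / θ.L ^ l) = P :=
  Nat.mul_div_cancel' (j.dvd_level hl)

/-- The label period is positive: `0 < P ∕ Lˡ` (`l ≤ k`). [cite: Balaban1985RegularSpaces, p.77 (bookkeeping)] -/
theorem IdxB8SubDPer.div_pos (j : IdxB8SubDPer θ P) {l : ℕ} (hl : l ≤ j.1.1.1.1.1.k) : 0 < P / θ.L ^ l :=
  Nat.div_pos (Nat.le_of_dvd j.pos (j.dvd_level hl)) (pow_pos (lt_of_lt_of_le (by norm_num) θ.two_le_L) l)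

/-- **A `P`-periodic member is an `n·P`-periodic member** (`1 ≤ n`): the torus may be taken as large as one pleases over the same domains.
[cite: Balaban1987RG1, (0.1) p.251 (bookkeeping)] -/
def IdxB8SubDPer.mulPeriod (j : IdxB8SubDPer θ P) {n : ℕ} (hn : 1 ≤ n) : IdxB8SubDPer θ (n * P) :=
  ⟨j.1, ⟨Nat.mul_pos (Nat.lt_of_lt_of_le Nat.zero_lt_one hn) j.pos, Dvd.dvd.mul_left j.dvd n⟩, fun l x m => by
    have h : ((n * P : ℕ) : ℤ) • m = (P : ℤ) • ((n : ℤ) • m) := by rw [Nat.cast_mul, mul_comm, mul_smul]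
    rw [h]
    exact j.periodic l x ((n : ℤ) • m)⟩

/-- `mulPeriod` keeps the member (`rfl`). [cite: Balaban1987RG1, (0.1) p.251 (bookkeeping)] -/
theorem IdxB8SubDPer.mulPeriod_val (j : IdxB8SubDPer θ P) {n : ℕ} (hn : 1 ≤ n) : (j.mulPeriod hn).1 = j.1 := rfl

/-! ## The torus reading: the domains as (finite) subsets of `(ℤ/Pℤ)ᵈ`, of which the `Ω_l ⊂ ℤᵈ` are the pull-backs -/

/-- **THE DOMAINS ON THE TORUS**: `Ω_l^𝕋 := {ξ ∈ (ℤ/Pℤ)ᵈ | its standard representative lies in Ω_l}` — print's `Ω_j ⊂ T_η` itself. [cite: Balaban1985RegularSpaces, p.77 («Ω_j ⊂ T_η»); Balaban1987RG1, (0.1) p.251] -/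
def IdxB8SubDPer.ΩTorus (j : IdxB8SubDPer θ P) (l : ℕ) : Set (Fin θ.D → ZMod P) :=
  {ξ | tlift ξ ∈ j.1.1.1.1.1.Ω l}

/-- `x ∈ Ω_l` iff the torus class of `x` lies in `Ω_l^𝕋`. [cite: Balaban1985RegularSpaces, p.77; Balaban1987RG1, (0.1) p.251 (bookkeeping)] -/
theorem IdxB8SubDPer.tcls_mem_ΩTorus_iff (j : IdxB8SubDPer θ P) (l : ℕ) (x : B7Prop1Explicit.Site θ.D) :
    tcls P x ∈ j.ΩTorus l ↔ x ∈ j.1.1.1.1.1.Ω l := by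
  haveI : NeZero P := ⟨j.pos.ne'⟩
  exact Iff.of_eq ((j.periodic l).apply_tlift x)

/-- **`Ω_l` IS the pull-back of `Ω_l^𝕋`** under the class map `ℤᵈ → (ℤ/Pℤ)ᵈ`. [cite: Balaban1985RegularSpaces, p.77; Balaban1987RG1, (0.1) p.251 (bookkeeping)] -/
theorem IdxB8SubDPer.tcls_preimage_ΩTorus (j : IdxB8SubDPer θ P) (l : ℕ) :
    tcls P ⁻¹' (j.ΩTorus l) = j.1.1.1.1.1.Ω l :=
  Set.ext fun x => j.tcls_mem_ΩTorus_iff l x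

/-- The torus domains are FINITE (N06's finite-`Ω₀` objects apply on the torus side). [cite: Balaban1985RegularSpaces, p.77 (bookkeeping: `T_η` is finite)] -/
theorem IdxB8SubDPer.ΩTorus_finite (j : IdxB8SubDPer θ P) (l : ℕ) : (j.ΩTorus l).Finite := by
  haveI : NeZero P := ⟨j.pos.ne'⟩
  exact Set.toFinite _

/-- `Ω_0^𝕋` is the whole torus. [cite: Balaban1985RegularSpaces, p.77 («Ω_j = T_η»)] -/
theorem IdxB8SubDPer.ΩTorus_zero (j : IdxB8SubDPer θ P) : j.ΩTorus 0 = Set.univ :=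
  Set.eq_univ_of_forall fun ξ => by
    show tlift ξ ∈ j.1.1.1.1.1.Ω 0
    rw [j.Ω_zero]; trivial

/-- The torus domains decrease ((1.3) on the torus). [cite: Balaban1985RegularSpaces, (1.3) p.77] -/
theorem IdxB8SubDPer.ΩTorus_anti (j : IdxB8SubDPer θ P) (l : ℕ) : j.ΩTorus (l + 1) ⊆ j.ΩTorus l :=
  fun _ hξ => j.domainSeq.anti l hξ

/-! ## The characterisation and the inhabitants -/

variable (θ)

/-- ★ **CHARACTERISATION — THE PERIODIC INDEX IS PRINT'S PERIODIC CLASS**: a triple `(η, k, Ω)` is carried by a member of `IdxB8SubDPer θ P` iff it is admissible (`0 < η`, `1 ≤ k`, `Lᵏη ≤ 1`,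
`Ω₀ = ℤᵈ`, (1.3)–(1.4) — dag-n05-w2's `exists_idxB8SubD_iff`) AND `0 < P`, `Lᵏ ∣ P`, every `Ω_l` `P`-periodic. [cite: Balaban1985RegularSpaces, (1.3)–(1.6) p.77, p.77 («Ω_j ⊂ T_η»), (1.68) p.88] -/
theorem exists_idxB8SubDPer_iff (η : ℝ) (k : ℕ) (Ω : ℕ → Set (B7Prop1Explicit.Site θ.D)) :
    (∃ j : IdxB8SubDPer θ P, j.1.1.1.1.1.η = η ∧ j.1.1.1.1.1.k = k ∧ j.1.1.1.1.1.Ω = Ω) ↔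
      (0 < η ∧ 1 ≤ k ∧ (θ.L : ℝ) ^ k * η ≤ 1 ∧ Ω 0 = Set.univ ∧ DomainSeq θ.L Ω) ∧
        (0 < P ∧ θ.L ^ k ∣ P) ∧ ∀ l, IsPeriodic P (fun x : B7Prop1Explicit.Site θ.D => x ∈ Ω l) := by
  constructor
  · rintro ⟨j, rfl, rfl, rfl⟩
    exact ⟨(B8IdxB8SubDRigidity.exists_idxB8SubD_iff θ _ _ _).1 ⟨j.1, rfl, rfl, rfl⟩, j.2.1, j.2.2⟩
  · rintro ⟨hadm, hP, hper⟩
    obtain ⟨j, h1, h2, h3⟩ := (B8IdxB8SubDRigidity.exists_idxB8SubD_iff θ η k Ω).2 hadm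
    refine ⟨⟨j, ?_, ?_⟩, h1, h2, h3⟩
    · rw [h2]; exact hP
    · rw [h3]; exact hper

/-- The all-torus domain sequence «Ω_j = T_η for all j» satisfies (1.3)–(1.4) (trivially). [cite: Balaban1985RegularSpaces, p.77 («we admit the case where some domains Ω_j are equal to T_η»)] -/
theorem domainSeq_univTower (L : ℕ) : DomainSeq L (fun _ : ℕ => (Set.univ : Set (B7Prop1Explicit.Site θ.D))) :=
  ⟨fun _ => subset_rfl, fun _ _ _ _ _ => trivial, fun _ _ _ _ _ => trivial⟩

/-- ★ **INHABITANT AT EVERY DEPTH AND PERIOD — PRINT'S ALL-TORUS TOWER «Ω_j = T_η for all j»** (G-B8-T2S's member class): for `k ≥ 1`, `0 < P`, `Lᵏ ∣ P` the periodic index carries a member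
of depth `k`, spacing `L⁻ᵏ` and domains `Ω ≡ ℤᵈ` (by the characterisation; its towers are then `Λ_l = ∅` for `l < k` and `Λ_k =` all level-`k` labels, by rigidity).
[cite: Balaban1985RegularSpaces, p.77 («we admit … Ω_j = T_η»), (1.3)–(1.5) p.77] -/
theorem exists_idxB8SubDPer_univTower {k : ℕ} (hk : 1 ≤ k) (hP : 0 < P) (hdvd : θ.L ^ k ∣ P) :
    ∃ j : IdxB8SubDPer θ P, j.1.1.1.1.1.η = ((θ.L : ℝ) ^ k)⁻¹ ∧ j.1.1.1.1.1.k = k ∧ j.1.1.1.1.1.Ω = fun _ => Set.univ := by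
  have hLpos : 0 < (θ.L : ℝ) ^ k := pow_pos (by exact_mod_cast lt_of_lt_of_le (by norm_num) θ.two_le_L) k
  refine (exists_idxB8SubDPer_iff θ _ k _).2 ⟨⟨inv_pos.2 hLpos, hk, ?_, rfl, domainSeq_univTower θ θ.L⟩, ⟨hP, hdvd⟩, fun _ _ _ => rfl⟩
  rw [mul_inv_cancel₀ hLpos.ne']

/-- The periodic index is non-empty at every period `P > 0` with `L ∣ P` (depth `k = 1`). [cite: Balaban1985RegularSpaces, p.77 (bookkeeping: the periodic class is inhabited)] -/
theorem nonempty_idxB8SubDPer (hP : 0 < P) (hdvd : θ.L ∣ P) : Nonempty (IdxB8SubDPer θ P) :=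
  let ⟨j, _⟩ := exists_idxB8SubDPer_univTower θ le_rfl hP (by rwa [pow_one])
  ⟨j⟩

/-- In particular at the period `P = Lᵏ` itself (the smallest torus tiled by the top blocks). [cite: Balaban1985RegularSpaces, p.77 (bookkeeping)] -/
theorem nonempty_idxB8SubDPer_pow {k : ℕ} (hk : 1 ≤ k) : Nonempty (IdxB8SubDPer θ (θ.L ^ k)) :=
  let ⟨j, _⟩ := exists_idxB8SubDPer_univTower θ hk (pow_pos (lt_of_lt_of_le (by norm_num) θ.two_le_L) k) dvd_rfl
  ⟨j⟩

end Literature.MathematicalPhysics.QuantumFieldTheory.Balaban1983to89.Node00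

end
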